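import Literature.NumberTheory.Automorphic.Liu2021.LemD1Item3AtVIsoOfLineTransport
import Literature.NumberTheory.GelbartRogawski1991.LocalSplittingCMLocality
import Summits.HodgeConjecture.CorCM.HypD3.A4LiuD3Items
import HarnessLib

/-!
# `hD3` line `a4-liuD3`, stub (:203) `stub_iso_of_params : IsoOfParams` — CLOSED MODULO the line-rigidity identity S6a (place-free)
# (cell `hodgecm-mathlib`, binder `HypD3` = [Liu2021, App. D Lem. D.1 (3)] AS PRINTED per finite place; crux item stmt-HodgeConjecture-24837)

Summits side, binder subdirectory `CorCM/HypD3/`.  The crux skeleton `Cruxes/HD3/Lines/a4_liuD3.lean` (v3 sha16 0c0090fa91a7e1e6, A-plan2;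
namespace `Summit.HodgeConjecture.CorCM.Lines.A4LiuD3`) cuts `hD3` into stubs over the family of record
`famAtV F e₁ dV hdV hdV0 ψ hψ aOf χOf v` (`A4LiuD3Items.lean`: `Def411WeilCarriers.localIndexedFamilyAtV F⁺ F c 3 e₁ (diagonal dV) … v`,
`F⁺ = maximalRealSubfield F`, `c = complexConj`, ONE trace-zero `δ = imagUnit F`, `e₁ = Equiv.prodUnique (Fin 3) (Fin 1)`, member
`t ↦ (a_t, χ_t, χ-splitting of μ_t := toHeckeCharacter (ψ t), localMu μ_t)`).  Its stub (:203) `IsoOfParams` is the «⇐» direction of (3) at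
EVERY finite place `v` of `F⁺` (no `IsField` guard): `μ_{j,v} = μ_{i,v}` ∧ `ε_i ~ ε_j` ∧ `χ_{j,v} = χ_{i,v}` ⟹ `ω(μ_j, ε_j, χ_j) ≅ ω(μ_i, ε_i, χ_i)`
(`AreIsomorphicRep (quot j) (quot i)`).

This file PROVES that statement MODULO the line-rigidity identity S6a of the `χ`-splitting (B-p13's architecture F6–F8,
`LocalKudlaSplittingRigidity.lean` and sequels; the registered residual `stub_lineRigidityS6a_nonsplit : LineRigidityS6aNonsplit` of v3 and its
all-places twin), taken as the EXPLICIT hypothesis `hS6a` in the PLACE-FREE per-instance shape of B-p18's `HypD3.kudla_of_lineRigidity`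
(`A4LiuD3KudlaOfLineRigidity.lean`; text = the `hS6a` binder of `HypD3.kudla_nonsplit_of_lineRigidity`, byte-identical):
«for every unit `x` with `a_j⁻¹δ ⊗ 1 = x xᶜ (a_i⁻¹δ ⊗ 1)`, the line transport by `x` of member `i`'s transported `χ`-splitting section on the
line `a_i` IS `μ_i`'s transported `χ`-splitting section on the line `a_j`».  PROOF (`isoOfParams_of_lineRigidity`):
(ε) the class hypothesis gives such an `x` (`Def411WeilCarriers.exists_lineDelta_witness_of_sameClass_eps`); (S6c) `μ_{j,v} = μ_{i,v}` makes
`μ_i`'s and `μ_j`'s `χ`-splitting sections at `v` on the line `a_j` EQUAL (B-p13's locality `undoubledSplittings_cmFinLocalFamily_s_congr_of_localMu_eq`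
∕ `congrW_s_congr`, `LocalSplittingCMLocality.lean`), hence equal transported sections (`lineTransportSection_congr`); so `hS6a x hx` reads
`lineTransportSplitting x (s_i) = s_j`, and the place-free plumbing `Def411WeilCarriers.areIsomorphicRep_quot_of_lineTransportSplitting_eq_prodUnique`
(`Liu2021/LemD1Item3AtVIsoOfLineTransport.lean`: `M_x⁻¹` equivariant + B-p13's `LemD1IndexedFamily.areIsomorphicRep_quot_of_equivariant`)
concludes with `χ_j = χ_i`.  The ∀-closed corollary `isoOfParams_of_lineRigidityS6a` concludes the REGISTERED stub type
`Summit.HodgeConjecture.CorCM.Lines.A4LiuD3.IsoOfParams` BY NAME from the ∀-closure of `hS6a` (= `LineRigidityS6aNonsplit` with the `IsField`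
line deleted) — so with ONE place-free residual `stub_lineRigidityS6a` the skeleton's slot is
`stub_iso_of_params := HypD3.isoOfParams_of_lineRigidityS6a stub_lineRigidityS6a`, and the same residual closes :190/:195 through
`HypD3.kudla_of_lineRigidity`.  No new fact, no definition, debt Δ 0.

HC_CM is proved only modulo the 7 printed citations (`hDel`, `h21`, `hLiu418`, `h411`, `h413`, `hD3`, `hD1''`) until rung 0 closes; this file
discharges no binder by itself (it closes one of five stubs of the `hD3` line, modulo S6a).

## References
* [Liu2021] Y. Liu, Camb. J. Math. 9 (2021) = arXiv:2102.11518, App. D §D.1 Steps 1–3 (l. 5213–5224), Lemma D.1 (3) (l. 5233), proof l. 5249–5255.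
* [MoeglinVignerasWaldspurger1987] C. Mœglin, M.-F. Vignéras, J.-L. Waldspurger, LNM 1291, Chap. 2 II.1, Chap. 3 I.1–I.3, IV.4.
* [Kudla1994] S. Kudla, Israel J. Math. 87 (1994), §3 Thm. 3.1 (explicit splittings; locality in the character).
* [HarrisKudlaSweet1996] M. Harris, S. Kudla, W. Sweet, JAMS 9 (1996), §1.
-/

set_option autoImplicit false

noncomputable section

namespace Summit.HodgeConjecture.CorCM.HypD3
open scoped TensorProduct Matrix
open NumberField NumberField.InfinitePlace
open Literature.NumberTheory.ComplexMultiplication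
open Literature.NumberTheory.Automorphic
open Literature.NumberTheory.Automorphic.IdeleClassGroup (toHeckeCharacter isUnitary_toHeckeCharacter)
open Literature.NumberTheory.Automorphic.Liu2021
open HodgeCM.Model.ArchSideTerm (e₁)
open Literature.NumberTheory.GelbartRogawski1991 Literature.NumberTheory.GelbartRogawski1991.UnitaryDualPair
open Literature.NumberTheory.GelbartRogawski1991.UnitaryDualPair.LocalSplitting (localMu norm_localMu continuous_localMu
  localMu_toLocalRing_eq_one_iff lineTransportSection conj_lineDelta lineDelta_ne_zero lineDelta_mul_self lineTransportSection_congr)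
open Literature.RepresentationTheory Literature.RepresentationTheory.Liu2021
open Literature.RepresentationTheory.MoeglinVignerasWaldspurger1987 (lineTransportSplitting)
open Summit.HodgeConjecture.CorCM.Transposition
open Summit.HodgeConjecture.CorCM.Lines.A4LiuD3 (famAtV IsoOfParams)
open Literature.NumberTheory.GelbartRogawski1991.GRConstruction (congrW_s_congr undoubledSplittings_cmFinLocalFamily_s_congr_of_localMu_eq)

-- heartbeats: elaborating the spelled `hS6a` binder alone exceeds the default budget (whnf/isDefEq on the packaged CM sections), as in
-- `A4LiuD3KudlaOfLineRigidity.lean` / `A4LiuD3SplitInjectiveOfFacts.lean`; the proof is four short steps.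
set_option maxHeartbeats 1600000 in
/-- **Line `a4-liuD3`, stub (:203) `IsoOfParams`, PROVED MODULO the place-free line-rigidity identity S6a** (hypothesis `hS6a`, the binder
shape of `HypD3.kudla_of_lineRigidity`): for every CM field `F` (as `HodgeCM.CMField`), real frame `dV`, index maps `ψ, hψ, aOf, χOf`, EVERY
finite place `v` of `F⁺` and members `i, j` of the family of record at `e₁`,
`(∀ x hx, lineTransportSplitting x (s_i) = s^{μ_i}_{a_j}) → μ_{j,v} = μ_{i,v} → ε_i ~ ε_j → χ_{j,v} = χ_{i,v} → ω(μ_j, ε_j, χ_j) ≅ ω(μ_i, ε_i, χ_i)`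
(`mu`, `LemD1.SameClass … eps`, `chi`, `AreIsomorphicRep … quot` of `famAtV`; the last four arrows are the body of the registered stub type
`IsoOfParams`).  Proof: class witness `x` (`exists_lineDelta_witness_of_sameClass_eps`) · locality of the `χ`-splitting section in `μ_v`
(`undoubledSplittings_cmFinLocalFamily_s_congr_of_localMu_eq`, `congrW_s_congr`, `lineTransportSection_congr`) · `hS6a x hx` ·
`areIsomorphicRep_quot_of_lineTransportSplitting_eq_prodUnique`. [cite: Liu2021, App. D Lemma D.1 (3) (l. 5233)]
[cite: MoeglinVignerasWaldspurger1987, Chap. 2 II.1, Chap. 3 I.1–I.3, IV.4] [cite: Kudla1994, §3 Thm. 3.1] -/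
theorem isoOfParams_of_lineRigidity :
    ∀ (F : HodgeCM.CMField) (dV : Fin 3 → (F : Type))
      (hdV : ∀ i, IsCMField.complexConj (F : Type) (dV i) = dV i) (hdV0 : ∀ i, dV i ≠ 0) {ι : Type}
      (ψ : ι → (Literature.NumberTheory.Automorphic.IdeleClassGroup (F : Type) →ₜ* Circle))
      (hψ : ∀ t, IdeleClassGroup.IsConjugateSymplectic (F : Type) (ψ t))
      (aOf : ι → (↥(maximalRealSubfield (F : Type)))ˣ)
      (χOf : ι → Def411WeilCarriers.Chi ↥(maximalRealSubfield (F : Type)) (F : Type) (IsCMField.complexConj (F : Type)))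
      (v : IsDedekindDomain.HeightOneSpectrum (𝓞 ↥(maximalRealSubfield (F : Type)))),
      ∀ i j : ι,
        (∀ (x : (UnitaryGroup.LocalRing (F : Type) v)ˣ) (hx : algebraMap (F : Type) (UnitaryGroup.LocalRing (F : Type) v) (algebraMap ↥(maximalRealSubfield (F : Type)) (F : Type) (↑(aOf j)⁻¹ : ↥(maximalRealSubfield (F : Type))) * imagUnit (F : Type)) =
            (x : (UnitaryGroup.LocalRing (F : Type) v)) * UnitaryGroup.conjLocal (F : Type) (IsCMField.complexConj (F : Type)) v x * algebraMap (F : Type) (UnitaryGroup.LocalRing (F : Type) v) (algebraMap ↥(maximalRealSubfield (F : Type)) (F : Type) (↑(aOf i)⁻¹ : ↥(maximalRealSubfield (F : Type))) * imagUnit (F : Type))),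
          lineTransportSplitting (F : Type) v (IsCMField.complexConj (F : Type)) 3 (conj_lineDelta (complexConj_imagUnit (F : Type)) (aOf i)) (lineDelta_ne_zero (imagUnit_ne_zero (F : Type)) (aOf i))
            (lineDelta_mul_self (imagUnit_mul_self (F : Type)) (aOf i)) (conj_lineDelta (complexConj_imagUnit (F : Type)) (aOf j)) (lineDelta_ne_zero (imagUnit_ne_zero (F : Type)) (aOf j))
            (lineDelta_mul_self (imagUnit_mul_self (F : Type)) (aOf j)) x (realDiagonal (F : Type) dV hdV) (realDiagonal_isSymm (F : Type) dV hdV) (isUnit_det_realDiagonal (F : Type) dV hdV hdV0) hx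
            (lineTransportSection ↥(maximalRealSubfield (F : Type)) (F : Type) (IsCMField.complexConj (F : Type)) 3 (complexConj_imagUnit (F : Type)) (imagUnit_ne_zero (F : Type)) (imagUnit_mul_self (F : Type)) (realDiagonal (F : Type) dV hdV) (realDiagonal_isSymm (F : Type) dV hdV) (Matrix.diagonal dV) (realDiagonal_map (F : Type) dV hdV).symm (aOf i) v ((OmegaChiSplitting.chiLocalSplittingsD ⟨HodgeCM.CMField.K F⟩ e₁ dV hdV hdV0 (toHeckeCharacter (F : Type) (ψ i)) ((isOscillatorChar_toHeckeCharacter_iff (ψ i)).mpr (hψ i)) (aOf i)).s v) ((OmegaChiSplitting.chiLocalSplittingsD ⟨HodgeCM.CMField.K F⟩ e₁ dV hdV hdV0 (toHeckeCharacter (F : Type) (ψ i)) ((isOscillatorChar_toHeckeCharacter_iff (ψ i)).mpr (hψ i)) (aOf i)).proj_s v)) =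
          (lineTransportSection ↥(maximalRealSubfield (F : Type)) (F : Type) (IsCMField.complexConj (F : Type)) 3 (complexConj_imagUnit (F : Type)) (imagUnit_ne_zero (F : Type)) (imagUnit_mul_self (F : Type)) (realDiagonal (F : Type) dV hdV) (realDiagonal_isSymm (F : Type) dV hdV) (Matrix.diagonal dV) (realDiagonal_map (F : Type) dV hdV).symm (aOf j) v ((OmegaChiSplitting.chiLocalSplittingsD ⟨HodgeCM.CMField.K F⟩ e₁ dV hdV hdV0 (toHeckeCharacter (F : Type) (ψ i)) ((isOscillatorChar_toHeckeCharacter_iff (ψ i)).mpr (hψ i)) (aOf j)).s v) ((OmegaChiSplitting.chiLocalSplittingsD ⟨HodgeCM.CMField.K F⟩ e₁ dV hdV hdV0 (toHeckeCharacter (F : Type) (ψ i)) ((isOscillatorChar_toHeckeCharacter_iff (ψ i)).mpr (hψ i)) (aOf j)).proj_s v))) →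
        (famAtV F e₁ dV hdV hdV0 ψ hψ aOf χOf v).mu j = (famAtV F e₁ dV hdV hdV0 ψ hψ aOf χOf v).mu i →
        LemD1.SameClass ((famAtV F e₁ dV hdV hdV0 ψ hψ aOf χOf v).eps i) ((famAtV F e₁ dV hdV hdV0 ψ hψ aOf χOf v).eps j) →
        (famAtV F e₁ dV hdV hdV0 ψ hψ aOf χOf v).chi j = (famAtV F e₁ dV hdV hdV0 ψ hψ aOf χOf v).chi i →
        AreIsomorphicRep ((famAtV F e₁ dV hdV hdV0 ψ hψ aOf χOf v).quot j) ((famAtV F e₁ dV hdV hdV0 ψ hψ aOf χOf v).quot i) := by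
  intro F dV hdV hdV0 ι ψ hψ aOf χOf v i j hS6a hmu hε hχ
  -- (ε) the class witness at the transported lines `a_i⁻¹δ`, `a_j⁻¹δ`
  obtain ⟨x, hx⟩ := Def411WeilCarriers.exists_lineDelta_witness_of_sameClass_eps ↥(maximalRealSubfield (F : Type)) (F : Type)
    (IsCMField.complexConj (F : Type)) 3 (Matrix.diagonal dV) (complexConj_imagUnit (F : Type)) (imagUnit_ne_zero (F : Type))
    (imagUnit_mul_self (F : Type)) e₁ (realDiagonal_isSymm (F : Type) dV hdV) (isUnit_det_realDiagonal (F : Type) dV hdV hdV0)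
    (realDiagonal_map (F : Type) dV hdV).symm (le_refl 3) aOf χOf
    (fun t => OmegaChiSplitting.chiLocalSplittingsD ⟨HodgeCM.CMField.K F⟩ e₁ dV hdV hdV0 (toHeckeCharacter (F : Type) (ψ t))
      ((isOscillatorChar_toHeckeCharacter_iff (ψ t)).mpr (hψ t)) (aOf t))
    (fun t => localMu (F : Type) (toHeckeCharacter (F : Type) (ψ t)))
    (fun t v x => norm_localMu (F : Type) (toHeckeCharacter (F : Type) (ψ t)) v (isUnitary_toHeckeCharacter (F : Type) (ψ t)) x)
    (fun t => continuous_localMu (F : Type) (toHeckeCharacter (F : Type) (ψ t)))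
    (fun t v x => localMu_toLocalRing_eq_one_iff (F : Type) (toHeckeCharacter (F : Type) (ψ t)) v
      ((isOscillatorChar_toHeckeCharacter_iff (ψ t)).mpr (hψ t)) x)
    v i j hε
  -- (S6c) `μ_{j,v} = μ_{i,v}` ⟹ `μ_i`'s and `μ_j`'s `χ`-splitting sections at `v` on the line `a_j` coincide
  have hμ : localMu (F : Type) (toHeckeCharacter (F : Type) (ψ i)) v = localMu (F : Type) (toHeckeCharacter (F : Type) (ψ j)) v :=
    (congrArg Subtype.val hmu).symm
  have hS : (OmegaChiSplitting.chiLocalSplittingsD ⟨HodgeCM.CMField.K F⟩ e₁ dV hdV hdV0 (toHeckeCharacter (F : Type) (ψ i))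
        ((isOscillatorChar_toHeckeCharacter_iff (ψ i)).mpr (hψ i)) (aOf j)).s v =
      (OmegaChiSplitting.chiLocalSplittingsD ⟨HodgeCM.CMField.K F⟩ e₁ dV hdV hdV0 (toHeckeCharacter (F : Type) (ψ j))
        ((isOscillatorChar_toHeckeCharacter_iff (ψ j)).mpr (hψ j)) (aOf j)).s v :=
    congrW_s_congr (F : Type) e₁ dV hdV _ _ _ _ _ _ _ _ _
      (undoubledSplittings_cmFinLocalFamily_s_congr_of_localMu_eq (F : Type) e₁ dV hdV hdV0 _ _ _ _ v
        (toHeckeCharacter (F : Type) (ψ i)) (toHeckeCharacter (F : Type) (ψ j)) _ _ hμ)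
  -- hence equal transported sections on the line `a_j`; `hS6a x hx` then says `lineTransportSplitting x (s_i) = s_j`
  have hsec := (hS6a x hx).trans (lineTransportSection_congr ↥(maximalRealSubfield (F : Type)) (F : Type) (IsCMField.complexConj (F : Type)) 3
    (complexConj_imagUnit (F : Type)) (imagUnit_ne_zero (F : Type)) (imagUnit_mul_self (F : Type)) (realDiagonal (F : Type) dV hdV)
    (realDiagonal_isSymm (F : Type) dV hdV) (Matrix.diagonal dV) (realDiagonal_map (F : Type) dV hdV).symm (aOf j) v
    ((OmegaChiSplitting.chiLocalSplittingsD ⟨HodgeCM.CMField.K F⟩ e₁ dV hdV hdV0 (toHeckeCharacter (F : Type) (ψ i))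
      ((isOscillatorChar_toHeckeCharacter_iff (ψ i)).mpr (hψ i)) (aOf j)).proj_s v)
    ((OmegaChiSplitting.chiLocalSplittingsD ⟨HodgeCM.CMField.K F⟩ e₁ dV hdV hdV0 (toHeckeCharacter (F : Type) (ψ j))
      ((isOscillatorChar_toHeckeCharacter_iff (ψ j)).mpr (hψ j)) (aOf j)).proj_s v) hS)
  -- (⇐) the place-free plumbing: `M_x⁻¹` equivariant between the carriers + equal Step-3 characters
  exact Def411WeilCarriers.areIsomorphicRep_quot_of_lineTransportSplitting_eq_prodUnique ↥(maximalRealSubfield (F : Type)) (F : Type)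
    (IsCMField.complexConj (F : Type)) 3 (Matrix.diagonal dV) (complexConj_imagUnit (F : Type)) (imagUnit_ne_zero (F : Type))
    (imagUnit_mul_self (F : Type)) (realDiagonal_isSymm (F : Type) dV hdV) (isUnit_det_realDiagonal (F : Type) dV hdV hdV0)
    (realDiagonal_map (F : Type) dV hdV).symm (le_refl 3) aOf χOf
    (fun t => OmegaChiSplitting.chiLocalSplittingsD ⟨HodgeCM.CMField.K F⟩ e₁ dV hdV hdV0 (toHeckeCharacter (F : Type) (ψ t))
      ((isOscillatorChar_toHeckeCharacter_iff (ψ t)).mpr (hψ t)) (aOf t))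
    (fun t => localMu (F : Type) (toHeckeCharacter (F : Type) (ψ t)))
    (fun t v x => norm_localMu (F : Type) (toHeckeCharacter (F : Type) (ψ t)) v (isUnitary_toHeckeCharacter (F : Type) (ψ t)) x)
    (fun t => continuous_localMu (F : Type) (toHeckeCharacter (F : Type) (ψ t)))
    (fun t v x => localMu_toLocalRing_eq_one_iff (F : Type) (toHeckeCharacter (F : Type) (ψ t)) v
      ((isOscillatorChar_toHeckeCharacter_iff (ψ t)).mpr (hψ t)) x)
    v i j x hx hsec hχ

set_option maxHeartbeats 1600000 in
/-- **The REGISTERED stub type `IsoOfParams` (:203) BY NAME, modulo the ∀-closed place-free S6a** — hypothesis text = the v3 residual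
`LineRigidityS6aNonsplit` (`a4_liuD3.lean` :172) with its `IsField (F ⊗ F⁺_v) →` line DELETED (the `hS6a` of `HypD3.kudla_of_lineRigidity`
∀-closed over `(F) (dV) (hdV) (hdV0) {ι} (ψ) (hψ) (aOf) (v) (i j)`).  Slot for the skeleton once that residual is registered as
`stub_lineRigidityS6a`: `stub_iso_of_params := HypD3.isoOfParams_of_lineRigidityS6a stub_lineRigidityS6a`; the same residual feeds
`HypD3.kudla_of_lineRigidity` for :190/:195. [cite: Liu2021, App. D Lemma D.1 (3) (l. 5233)] [cite: MoeglinVignerasWaldspurger1987, Chap. 3 IV.4] -/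
theorem isoOfParams_of_lineRigidityS6a
    (hS6a :
      ∀ (F : HodgeCM.CMField) (dV : Fin 3 → (F : Type))
          (hdV : ∀ i, IsCMField.complexConj (F : Type) (dV i) = dV i) (hdV0 : ∀ i, dV i ≠ 0) {ι : Type}
          (ψ : ι → (Literature.NumberTheory.Automorphic.IdeleClassGroup (F : Type) →ₜ* Circle))
          (hψ : ∀ t, IdeleClassGroup.IsConjugateSymplectic (F : Type) (ψ t))
          (aOf : ι → (↥(maximalRealSubfield (F : Type)))ˣ)
          (v : IsDedekindDomain.HeightOneSpectrum (𝓞 ↥(maximalRealSubfield (F : Type)))),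
          ∀ i j : ι,
            ∀ (x : (UnitaryGroup.LocalRing (F : Type) v)ˣ) (hx : algebraMap (F : Type) (UnitaryGroup.LocalRing (F : Type) v) (algebraMap ↥(maximalRealSubfield (F : Type)) (F : Type) (↑(aOf j)⁻¹ : ↥(maximalRealSubfield (F : Type))) * imagUnit (F : Type)) =
                (x : (UnitaryGroup.LocalRing (F : Type) v)) * UnitaryGroup.conjLocal (F : Type) (IsCMField.complexConj (F : Type)) v x * algebraMap (F : Type) (UnitaryGroup.LocalRing (F : Type) v) (algebraMap ↥(maximalRealSubfield (F : Type)) (F : Type) (↑(aOf i)⁻¹ : ↥(maximalRealSubfield (F : Type))) * imagUnit (F : Type))),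
              lineTransportSplitting (F : Type) v (IsCMField.complexConj (F : Type)) 3 (conj_lineDelta (complexConj_imagUnit (F : Type)) (aOf i)) (lineDelta_ne_zero (imagUnit_ne_zero (F : Type)) (aOf i))
                (lineDelta_mul_self (imagUnit_mul_self (F : Type)) (aOf i)) (conj_lineDelta (complexConj_imagUnit (F : Type)) (aOf j)) (lineDelta_ne_zero (imagUnit_ne_zero (F : Type)) (aOf j))
                (lineDelta_mul_self (imagUnit_mul_self (F : Type)) (aOf j)) x (realDiagonal (F : Type) dV hdV) (realDiagonal_isSymm (F : Type) dV hdV) (isUnit_det_realDiagonal (F : Type) dV hdV hdV0) hx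
                (lineTransportSection ↥(maximalRealSubfield (F : Type)) (F : Type) (IsCMField.complexConj (F : Type)) 3 (complexConj_imagUnit (F : Type)) (imagUnit_ne_zero (F : Type)) (imagUnit_mul_self (F : Type)) (realDiagonal (F : Type) dV hdV) (realDiagonal_isSymm (F : Type) dV hdV) (Matrix.diagonal dV) (realDiagonal_map (F : Type) dV hdV).symm (aOf i) v ((OmegaChiSplitting.chiLocalSplittingsD ⟨HodgeCM.CMField.K F⟩ e₁ dV hdV hdV0 (toHeckeCharacter (F : Type) (ψ i)) ((isOscillatorChar_toHeckeCharacter_iff (ψ i)).mpr (hψ i)) (aOf i)).s v) ((OmegaChiSplitting.chiLocalSplittingsD ⟨HodgeCM.CMField.K F⟩ e₁ dV hdV hdV0 (toHeckeCharacter (F : Type) (ψ i)) ((isOscillatorChar_toHeckeCharacter_iff (ψ i)).mpr (hψ i)) (aOf i)).proj_s v)) =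
              (lineTransportSection ↥(maximalRealSubfield (F : Type)) (F : Type) (IsCMField.complexConj (F : Type)) 3 (complexConj_imagUnit (F : Type)) (imagUnit_ne_zero (F : Type)) (imagUnit_mul_self (F : Type)) (realDiagonal (F : Type) dV hdV) (realDiagonal_isSymm (F : Type) dV hdV) (Matrix.diagonal dV) (realDiagonal_map (F : Type) dV hdV).symm (aOf j) v ((OmegaChiSplitting.chiLocalSplittingsD ⟨HodgeCM.CMField.K F⟩ e₁ dV hdV hdV0 (toHeckeCharacter (F : Type) (ψ i)) ((isOscillatorChar_toHeckeCharacter_iff (ψ i)).mpr (hψ i)) (aOf j)).s v) ((OmegaChiSplitting.chiLocalSplittingsD ⟨HodgeCM.CMField.K F⟩ e₁ dV hdV hdV0 (toHeckeCharacter (F : Type) (ψ i)) ((isOscillatorChar_toHeckeCharacter_iff (ψ i)).mpr (hψ i)) (aOf j)).proj_s v))) :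
    IsoOfParams := by
  intro F dV hdV hdV0 ι ψ hψ aOf χOf v i j
  exact isoOfParams_of_lineRigidity F dV hdV hdV0 ψ hψ aOf χOf v i j (hS6a F dV hdV hdV0 ψ hψ aOf v i j)

end Summit.HodgeConjecture.CorCM.HypD3

end
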